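import Mathlib
import HarnessLib
import HarnessLib.Audit
import Summits.QuantumAdvantage.Statement
import Literature.Computability.MetaComplexity.ProofSystems
import Literature.Computability.QuantumComplexity.StabilizerRank
import Literature.Computability.Complexity.CNF
import Literature.Computability.Cryptography.TCount
import Literature.Computability.Complexity.CircuitClasses
import Literature.Barriers.QuantumAdvantage.BoundedEntanglement
import Literature.Computability.Complexity.ProbabilisticClassesProofs
import HarnessLib.Audit.Status.Attr

/-!
Route: AmplitudeProofs

DORMANT since 2026-08-22T16:46:35Z (reconciler: no traction for 5.5 d (last activity item-evidence-added at 2026-08-17T04:18:48Z); parked, not closed — `ledger route dormant route-QuantumAdvantage-AmplitudeProofs --off` to reactivate) — unstaffed, not closed; items shared with open routes are served there. `ledger route dormant <id> --off` reactivates.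

Route AmplitudeProofs (idea card QuantumAdvantage/QuantumAdvantage/amplitude-proof-complexity:
"simulators are provers").
NEGATION-side thesis X_P (targets ¬QuantumAdvantage, like route Dequantize, but through PROOF LENGTH
instead of a measure):
Words: gap-acceptance statements "Pr[C accepts x] >= 2/3" of oracle-free Clifford+T circuits admit a
sound polynomial-time
verifier V (nothing with acceptance <= 1/3 has a V-proof) together with a polynomial-time proof
FINDER A that succeeds on every
instance with acceptance >= 2/3 — an amplitude proof system that is polynomially bounded AND
automatizable on the BQP promise.
Lean (decl ApcThesis): ∃ V A, IsPolyTimeVerifier V ∧ A ∈ FP ∧ (∀ n m C x π, C.IsOracleFree → V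
⟨⟨C⟩,x⟩ π = true → 1/3 < C.acceptProb 0 x)
∧ (∀ n m C x, C.IsOracleFree → 2/3 ≤ C.acceptProb 0 x → V ⟨⟨C⟩,x⟩ (A ⟨⟨C⟩,x⟩) = true), with ⟨⟨C⟩,x⟩
:= boolPair (QCircuit.sigmaEncode ⟨n,m,C⟩) (List.ofFn x)
over Literature.Computability.MetaComplexity.IsPolyTimeVerifier,
Literature.Computability.Complexity.FP, Literature.Computability.Cryptography.QCircuit.acceptProb.
X_P → BQP ⊆ P (ApcCollapse) → ¬QuantumAdvantage (Assembly, with the tree theorem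
P_subset_BPP_holds). X_P is the Cook–Reckhow
form of PromiseBQP ⊆ PromiseP and is EXPECTED FALSE; the route's earnable content is the S-side:
every CERTIFYING classical
simulator (stabilizer-sum / stabilizer-rank engines, ZX-calculus+BIGSUM decomposition engines) is
proof search in a concrete
Cook–Reckhow proof system Π for exact amplitude statements ⟨0|C|0⟩ = s, so a LOWER BOUND ON Π-PROOF
LENGTH for an explicit uniform
circuit family retires the whole class of simulators searching Π at once (Haken's theorem retires
all DPLL solvers), independently of
the heuristics; and FEASIBLE INTERPOLATION / the feasible disjunction property of Π turns
cryptographic hardness (FACT ∉ P/poly) into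
Π-length lower bounds on Shor/RSA split families (Krajíček–Pudlák 1998 / Bonet–Pitassi–Raz 2000
transplanted).
The ladder of Π's, weakest first: SD = gate-by-gate stabilizer sums with exact merges (proof length
≍ exact stabilizer rank of the
prefix states: cruxes ApcPrefixRankSuperpoly, ApcMagicRankExponential, typed now) < tree-like
ZX_{π/4}+BIGSUM (Kissinger–van de
Wetering engines; crux ApcTreeLikeZXPHP, informal until the derivation notion lands) < dag-like /
parametric ZX (crux ApcDisjunctionProperty).

Rationale: WHY THIS LINE. Proof complexity is the one area where unconditional exponential lower bounds against
rich SEARCH procedures are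
routine (Haken85 for resolution, Razborov/IPS for polynomial calculus, interpolation for CP), and a
certifying simulator IS a prover:
its transcript is a derivation in a sound calculus for amplitude statements, whose existence is
guaranteed by completeness of ZX for
Clifford+T (JeandelPerdrixVilmart2018) and whose Cook–Reckhow theory is typed in the tree
(MetaComplexity.ProofSystems: IsProofSystemFor,
IsPolyBounded, PSimulates, hasPolyBoundedProofSystem_iff_mem_NP_holds). Imported area:
propositional/algebraic proof complexity
(CookReckhow1979, Haken1985, KrajicekProofComplexity2019 ch.16-18, KrajicekPudlak1998,
BonetPitassiRaz2000, Capelli2019 = Cook–Reckhow for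
#SAT) with the explicit dictionary tautology ↦ exact amplitude statement, refutation ↦ derivation to
the zero diagram, solver ↦
certifying simulator, proof length ↦ simulation time, interpolant ↦ factoring circuit, decision-DNNF
certificate ↦ stabilizer sum.
Two facts make the dictionary bite: (i) zero-amplitude AMP0 is C=P-complete (FennerEtAl1999 Thm
GapP→quantum; AdlemanDeMarraisHuang1997),
so by Cook–Reckhow AMP0 has a p-bounded proof system iff C=P ⊆ NP (ApcCookReckhow); (ii) UNSAT ≤p
AMP0 by the Toffoli+Hadamard counting
circuit (ApcUnsatReduces; cf. the ZH representation of #SAT, arXiv:2004.06455 Thm 'zh-sat-rep'), so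
every amplitude proof system IS a
propositional refutation system on CNF-diagrams and the classical hierarchy (tree-like Res(⊕) ≤ ? ≤
PCR/ℚ(ω) ≤ Frege) calibrates it.
RANKED CRUXES. (2, informal; def wanted) ApcTreeLikeZXPHP: tree-like ZX_{π/4}+BIGSUM refutations of
the pigeonhole CNF-diagrams D(PHP^{n+1}_n)
have superpolynomial size — the first length lower bound for a complete graphical calculus; kills
every KvdW-type engine (arXiv:2109.01076,
2202.09202) on a P-uniform poly-size Toffoli+H family. Lower comparator: tree-like R(LIN) needs
2^{Ω(n)} on PHP (Itsykson–Sokolov;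
KrajicekProofComplexity2019 §18.8 p.401, Thm 18.6.4); upper comparator: PC over any field needs
degree > n/2 and 2^{Ω(n)} monomials
(Thm 16.2.1 Razborov, Thm 16.2.4(ii) IPS). The open content = does INTERFERENCE (cancelling
complex-weighted branches) shorten classical
refutations? (2', informal) ApcDisjunctionProperty: BIGSUM-free ZX_{π/4} has the feasible
disjunction property for juxtaposed closed
diagrams (KrajicekProofComplexity2019 §17.9); parametric upgrade = feasible interpolation ⇒ under
FACT ∉ P/poly no short parametric ZX proofs of
the RSA/Shor split family (Thm 18.7.2/18.7.3 transplanted). (3, typed) ApcPrefixRankSuperpoly: some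
uniform family has prefix states of
superpolynomial EXACT stabilizer rank = the SD system is not p-bounded = no gate-by-gate
stabilizer-sum simulator with arbitrary exact
merging runs in poly time; its negation gives BQP ⊆ P/poly (ApcPolyPrefixRankCollapse). (4, typed)
ApcMagicRankExponential: χ(T^{⊗t}) ≥ (1+ε)^t —
Haken-strength for SD on the magic family (SD proofs have size ≤ 2^t·poly: ApcTcountProofs), implies
(3) via ApcOfMagicRank.
KILL CRITERIA. Poly-length tree-like ZX+BIGSUM refutations of PHP-diagrams (a graphical Buss87: ZX
does counting) refute (2) and move the line
to families hard for CP/Frege-like counting (clique-colouring, random k-CNF) or close it; a JPV18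
rule with a disconnected non-scalar pattern
mixing components cheaply refutes (2'); χ(T^{⊗t}) = 2^{o(t)} refutes (4) (not (3)); a proof that
tree-like ZX+BIGSUM p-simulates Frege on
CNF-diagrams makes (2) hopeless (Frege lower bounds) → close as exhausted with census.
NOT DECOMPOSED YET. The calculus-level content waits for ONE definition (below); automatizability of
the ladder; the sum-over-paths variant
(arXiv:1805.06908, 2205.02600); approximate (weak-simulation) versions of (3)/(4), which belong to
route Dequantize (DeqNegStabrankSuperpoly ⇒ (3)).
TWO-LAYER PLAN. Foreseen split of (2) once typed: ApcTreeLikeZXPHP ⇐ [ZXTreeBelowPCR: tree-like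
ZX_{π/4}+BIGSUM refutations of CNF-diagrams are
p-simulated by PCR over ℚ(ω)] → [PCRPHPLowerBound: Literature fact, KrajicekProofComplexity2019 Thm
16.2.1 + 16.2.4(ii)] → ApcTreeLikeZXPHP; if
ZXTreeBelowPCR fails through interference, resplit via a #SAT-proof-system comparator (Capelli2019
KCPS / decision-DNNF width) with
stabilizer (affine, quadratic-phase) leaves. Foreseen split of (3): explicit superlinear exact rank
first (PSV22 frontier), then superpolynomial.
DEFINITION REQUESTS. zxBigSumRefutation (Literature/Computability/QuantumComplexity): closed
Clifford+T ZX-diagrams with the JPV18 rule set,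
BIGSUM-free derivation length, tree-like ZX+BIGSUM refutations and their size, and the CNF-diagram
map F ↦ D_F; it types cruxes (2), (2').
CHEAPEST FALSIFIER. For (2): write down the ZX+BIGSUM refutation that a KvdW engine (quizx,
arXiv:2109.01076) produces on D(PHP^{n+1}_n) for
n ≤ 12 and fit its size — polynomial growth, or a hand derivation of PHP by diagrammatic COUNTING
(W-spider arithmetic), kills (2) as stated;
for (2'): scan JPV18 Fig. 1 for a rule whose two sides are disconnected in a non-scalar way (a
lookup in the rule table; NOT verified here —
the tex-extracted text drops the figure; the known scalar rules (IV),(ZO) are harmless,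
(SUP)/(BW)-type patterns are the suspects); for (4): any decomposition with χ(T^{⊗m}) < 2^{0.3 m} at
small m lowers the bar but only a
2^{o(t)} family refutes; for the frame: nothing to run (X_P is expected false by design).
PRIOR-PROGRAMME NOTES: not read (plancard mode; none needed).

Novelty: NOVELTY (searched 2026-08-15 BEFORE claiming: `lit vsearch` "proof complexity lower bounds
ZX-calculus derivations / stabilizer decomposition" (books only: Krajicek2019, AroraBarak2009,
Jukna2012 — nothing quantum), `lit galaxy search --star all/pdf` "proof complexity of model
counting" (0), "feasible interpolation" (15 classical hits: Pudlak, BPR, Beyersdorff QBF),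
"stabiliser decompositions" (arXiv:2403.10964 Sutcliffe–Kissinger cutting; arXiv:2202.09202),
"sum-over-paths" (Amy, Vilmart); `lit read` + grep of arXiv:2004.06455, 1903.04039, 2202.09202,
1705.11151, quant-ph/9812056, 2212.08048, 2304.02524, 1805.02175, 2202.09194, 0903.0675,
book:krajind-proof-complexity ch.16–18; `lit search` (searchd) was DOWN all session (rc 75 / reset)
— re-audit should run "proof complexity ZX lower bound", "length of ZX derivations", "Res(lin)
stabilizer", "interpolation quantum circuits"; card audit refs doi:10.2307/2273702,
doi:10.1109/CCC.2009.9 (Hrubeš–Tzameret PI proofs) read as given.)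
Nearest prior art, three bodies never joined: (A) Cook–Reckhow for COUNTING: Capelli2019
(arXiv:1903.04039 p.2,7: knowledge compilers as Cook–Reckhow proof systems for #SAT, lower bounds
lifted from decision-DNNF size) and the MICE/CPOG line — classical, unweighted; (B) graphical
calculi as #SAT/simulation ENGINES: arXiv:2004.06455 (de Beaudrap–Kissinger–Meichanetzidis, p.9: a
ZH rewrite rule IS Davis–Putnam resolution; complexity diagnosed by arity growth, no length bounds),
arXiv:2212.08048 (graphic  [refs: 10.2307/2273702, 10.1109/CCC.2009.9, 2403.10964, 2202.09202, 2004.06455, 1903.04039, 2212.08048, 2109.01076, 0903.0675, book:krajind-proof-complexity, doi:10.2307/2273702, doi:10.1109/CCC.2009.9, Krajicek2019, AroraBarak2009, Jukna2012, Capelli2019, JeandelPerdrixVilmart2018, Haken1985, KrajicekProofComplexity2019, KrajicekPudlak1998, BonetPitassiRaz2000, FennerEtAl1999, PelegShpilkaVolk2022, Mehr]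

Barriers (technique_class: proof-complexity, interpolation, simulation, lower-bound): technique_class: proof-complexity, interpolation, simulation, lower-bound
- Literature.Barriers.QuantumAdvantage.Relativization: APPLIES to the target X_P (⇒ BQP ⊆ P, which
fails relative to the BV97/Simon oracles and holds relative to a PSPACE-complete one;
Relativization.not_relativizes_collapse_shape): any proof of X_P must be non-relativizing — and the
line IS non-relativizing in kind: a proof system manipulates the explicit gate list / ZX-diagram of
C, oracle gates have no rewrite rules, and the S-side cruxes (length lower bounds for a fixed
calculus, stabilizer rank of explicit states) are statements about syntax and explicit vectors with
no oracle slot. Not a claim of evasion for the (expected false) target; the earnable items are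
untouched.
- Literature.Barriers.QuantumAdvantage.Algebrization: same verdict
(Algebrization.not_isAlgebrizingInclusion_bqp_bpp: BQP ⊆ BPP does not algebrize); the route uses no
arithmetization/low-degree extension; the cruxes are oracle-free syntactic statements.
- Literature.Barriers.QuantumAdvantage.NaturalProofs: touches only the conditional reading of
ApcDisjunctionProperty (FACT ∉ P/poly ASSUMED, as in CircuitLB) and, in spirit, the rank cruxes:
stabilizer rank is a formal complexity measure on STATES, not a P/poly-natural property of Boolean
functions, so NaturalProofs.no_naturalProof_bqp_not_ppoly does not apply formally; honest caveat:
rank-type measures have their own "natural-proofs-like" obstruction (most states have near-maximal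

History (route lifecycle, newest last):
- 2026-08-16T04:14:48Z · AUTO-CRUX (backfill): ApcThesis — hypotheses of the deciding theorem that nothing in the route derives are cruxes (operator:999:1085951)
- 2026-08-22T16:46:35Z · DORMANT — reconciler: no traction for 5.5 d (last activity item-evidence-added at 2026-08-17T04:18:48Z); parked, not closed — `ledger route dormant route-QuantumAdvantage (operator:999:3291873)

sub-problem: QuantumAdvantage · status: dormant · opened planner-plancard-QuantumAdvantage-QuantumAdva-2c95901f-0 2026-08-15T11:07:09Z · rev 4 · ledger route-QuantumAdvantage-AmplitudeProofs
GENERATED by the gate from the ledger (D-0016/17). Provers cite these decls: `theorem foo : Summit.QuantumAdvantage.QuantumAdvantage.Theses.AmplitudeProofs.<Decl> := …` in Summits/QuantumAdvantage/QuantumAdvantage/Theorems/<Name>.lean.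
-/

namespace Summit.QuantumAdvantage.QuantumAdvantage.Theses.AmplitudeProofs

open scoped BigOperators Topology Manifold Classical MeasureTheory ProbabilityTheory Matrix InnerProductSpace ComplexConjugate ContinuousMap
open Filter Set Function TopologicalSpace MeasureTheory

attribute [summit_statement] _root_.QuantumAdvantage

open Literature.QuantumAdvantage

/-- item stmt-QuantumAdvantage-2697 · crux (kind.auto-crux: conjecture-grade) · rank 0 · open · by planner
why it might fail: Expected FALSE: puts FACT in P (Shor; tree fact FACT_mem_BQP), is PromiseBQP ⊆ PromiseP in verifier form, and BQP^O ⊄ BPP^O for the BV97/Simon oracles; filed as the negation-side frame (as DeqThesis) for the S-side kills.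
sources: CookReckhow1979, BernsteinVazirani1997, Shor1997, Watrous2009
[target] X_P of card amplitude-proof-complexity (negation side): gap-acceptance statements 'Pr[C
accepts x] >= 2/3' of oracle-free Clifford+T circuits (encoded as boolPair (sigmaEncode <n,m,C>) x)
admit a SOUND polynomial-time verifier V (a V-proof forces acceptance > 1/3) and a polynomial-time
proof FINDER A succeeding whenever acceptance >= 2/3: an amplitude proof system that is polynomially
bounded AND automatizable on the BQP promise. Equivalent to PromiseBQP ⊆ PromiseP in Cook–Reckhow
form (V,A ↦ the P-separator {s | V s (A s)}); implies BQP ⊆ P (ApcCollapse) hence ¬QuantumAdvantage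
(Assembly). EXPECTED FALSE — it is the frame against which the S-side cruxes (length lower bounds
for concrete amplitude proof systems: SD, tree-like ZX+BIGSUM, parametric ZX) are kills of whole
simulator classes. [CookReckhow1979 §1; Watrous2009 §III.2 (PromiseBQP); BernsteinVazirani1997 §8] -/
@[route_item "route-QuantumAdvantage-AmplitudeProofs", crux]
def ApcThesis : Prop :=
  ∃ (V : List Bool → List Bool → Bool) (A : List Bool → List Bool), Literature.Computability.MetaComplexity.IsPolyTimeVerifier V ∧ A ∈ Literature.Computability.Complexity.FP ∧ (∀ (n m : ℕ) (C : Literature.Computability.Cryptography.QCircuit Literature.Computability.Cryptography.cliffordT (n + m)) (x : Literature.Computability.Cryptography.QReg n) (π : List Bool), C.IsOracleFree → V (Literature.Computability.Complexity.boolPair (Literature.Computability.Cryptography.QCircuit.sigmaEncode ⟨n, m, C⟩) (List.ofFn x)) π = true → (1 : ℝ) / 3 < C.acceptProb 0 x) ∧ (∀ (n m : ℕ) (C : Literature.Computability.Cryptography.QCircuit Literature.Computability.Cryptography.cliffordT (n + m)) (x : Literature.Computability.Cryptography.QReg n), C.IsOracleFree → (2 : ℝ) / 3 ≤ C.acceptProb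 0 x → V (Literature.Computability.Complexity.boolPair (Literature.Computability.Cryptography.QCircuit.sigmaEncode ⟨n, m, C⟩) (List.ofFn x)) (A (Literature.Computability.Complexity.boolPair (Literature.Computability.Cryptography.QCircuit.sigmaEncode ⟨n, m, C⟩) (List.ofFn x))) = true)

-- item stmt-QuantumAdvantage-2779 · crux · rank 2 · open · by planner — informal only, no Lean statement yet:
--   [crux] (rank 2, the heart of the card; informal until the definition zxBigSumRefutation lands)
--   Tree-like ZX+BIGSUM refutations of the pigeonhole CNF-diagrams have superpolynomial size. Setting:
--   closed Clifford+T ZX-diagrams with the complete rule set ZX_{π/4} of JeandelPerdrixVilmart2018 (Fig.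
--   1); BIGSUM = the linear-combination rule that replaces a diagram by the formal ℤ[ω,1/2]-sum of the
--   two diagrams obtained by splitting one T-spider (equivalently one Boolean wire) — the case split of
--   the stabiliser-decomposition engines of Kissinger–van de Wetering (arXiv:2109.01076 §3) and
--   Kissinger–van

-- item stmt-QuantumAdvantage-2780 · crux · rank 2 · open · by planner — informal only, no Lean statement yet:
--   [crux] (rank 2', informal until zxBigSumRefutation lands; the interpolation leg of the card)
--   BIGSUM-free ZX_{π/4} has the FEASIBLE DISJUNCTION PROPERTY for juxtaposed closed diagrams: there is
--   a polynomial-time procedure which, from a derivation π (sequence of JeandelPerdrixVilmart2018 rule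
--   applications) of D₁ ⊗ D₂ = 0 for closed Clifford+T diagrams D₁, D₂ placed side by side (so ⟦D₁⟧·⟦D₂⟧
--   = 0), outputs i ∈ {1,2} together with a derivation of D_i = 0 of length ≤ |π|
--   (KrajicekProofComplexity2019 §17.9 p.375, 'feasible disjunction property'; Pudlák's existential
--   interpolation). Intended upgrade

/-- item stmt-QuantumAdvantage-2698 · crux · rank 3 · open · by planner
why it might fail: False iff EVERY uniform family has polynomial exact prefix rank (then BQP ⊆ P/poly, ApcPolyPrefixRankCollapse) — not excluded by any theorem; and beyond present technique: explicit exact stabilizer-rank lower bounds are Θ(n) (PSV22 Thm 1.1; §1.5 'incapable of super-linear').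
sources: PelegShpilkaVolk2022, arXiv:2106.03214, MehrabanTahmasbi2024, BravyiGosset2016, BravyiEtAl2019
[crux] SD-level kill (weakest amplitude proof system = gate-by-gate stabilizer sums with exact
merges, whose proof length on (C,x) is sandwiched between max_j χ(stateAfter x j) and poly·Σ_j
χ(stateAfter x j)): there is a poly-time-uniform oracle-free Clifford+T family F whose prefix states
U_{g_j}⋯U_{g_1}|x 0…0⟩ have superpolynomial EXACT stabilizer rank along some inputs: ∀c ∃x j, |x|^c
+ c < χ(F.stateAfter x j). Consequence: no simulator that maintains an exact stabilizer
decomposition of the current state (with arbitrarily clever exact re-merging,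
BG16/BBCCGH19/Qassim-et-al style) runs in polynomial time on F; its NEGATION gives BQP ⊆ P/poly
(ApcPolyPrefixRankCollapse). Weaker than (implied by) superpolynomial exact rank of |T>^{⊗t}
(ApcOfMagicRank), a fortiori by Dequantize's DeqNegStabrankSuperpoly (approximate rank); the extra
freedom (any uniform family, any prefix, any input — e.g. states with arithmetic structure forced by
uniformity, Choi states of modular exponentiation) is what a new lower-bound technique may exploit.
Why it might fail: see field. [PelegShpilkaVolk2022 = arXiv:2106.03214 Thm 1.1 (χ(T^{⊗n}) = Ω(n)),
§1.5 ('incapable of proving super-linear lower bounds') -/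
@[route_item "route-QuantumAdvantage-AmplitudeProofs"]
def ApcPrefixRankSuperpoly : Prop :=
  ∃ F : Literature.Computability.Cryptography.QCircuitFamily Literature.Computability.Cryptography.cliffordT, F.IsOracleFree ∧ F.IsUniform ∧ ∀ c : ℕ, ∃ (x : List Bool) (j : ℕ), x.length ^ c + c < Literature.Computability.QuantumComplexity.stabilizerRank (F.stateAfter x j)

/-- item stmt-QuantumAdvantage-2699 · crux · rank 4 · open · by planner
why it might fail: May be FALSE: χ(T^{⊗t}) = 2^{o(t)} is open (the upper exponent fell 0.5 → 0.468 → 0.396: BG16, BSS16, arXiv:2202.09202 p.7) and nothing beyond Ω(t) is proved (PSV22 Thm 1.1; methods stall at linear, §1.5).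
sources: PelegShpilkaVolk2022, BravyiSmithSmolin2016, BravyiGosset2016, arXiv:2202.09202, BravyiEtAl2019
[crux] Haken-strength form for the weakest system: the exact stabilizer rank of the magic family is
exponential, ∃ε>0 ∀t, χ(|T>^{⊗t}) ≥ (1+ε)^t. Reading: SD-proofs (and T-splitting certificates,
ApcTcountProofs: size ≤ 2^t·poly) of amplitude statements of T-count-t circuits are optimal up to
the constant in the exponent — the analogue of Haken85's 2^{Ω(n)} for resolution/PHP at the bottom
of the amplitude-proof-system ladder; implies ApcPrefixRankSuperpoly via ApcOfMagicRank. Known: Ω(t)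
≤ χ(T^{⊗t}) ≤ 2^{0.396 t} (PSV22 Thm 1.1; Qassim–Pashayan–Gosset 2021 via arXiv:2202.09202 p.3,7;
BSS16 χ(T^{⊗6}) ≤ 7 gives 0.468; BG16 0.5). Imported tools so far: higher-order Fourier analysis /
quadratic-phase structure of stabilizer states (PSV22), probabilistic method (MT24). Why it might
fail: see field. -/
@[route_item "route-QuantumAdvantage-AmplitudeProofs"]
def ApcMagicRankExponential : Prop :=
  ∃ ε : ℝ, 0 < ε ∧ ∀ t : ℕ, (1 + ε) ^ t ≤ (Literature.Computability.QuantumComplexity.stabilizerRank (Literature.Computability.QuantumComplexity.tensorPow Literature.Computability.QuantumComplexity.magicT t) : ℝ)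

/-- item stmt-QuantumAdvantage-2700 · support · rank 10 · open · by planner
sources: CookReckhow1979, BernsteinVazirani1997
[support] The dequantization law (Cook–Reckhow, promise level): X_P → BQP ⊆ P. Proof: for L ∈ BQP
with uniform family F, on input x compute ⟨|x|, ancillas, F.circ |x|⟩ in poly time (IsUniform
outputs exactly sigmaEncode), form s = boolPair (sigmaEncode …) x, run A then V; x ∈ L ⇒ acceptance
≥ 2/3 ⇒ V accepts A's proof; x ∉ L ⇒ acceptance ≤ 1/3 ⇒ V accepts nothing. Routine composition of
PolyTimeComputable maps (tree: IsUniform, FP, IsPolyTimeVerifier, mem_BQP_iff). With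
P_subset_BPP_holds it yields Assembly. [CookReckhow1979 §1 Prop 1.4 pattern; BernsteinVazirani1997
Def 8] -/
@[route_item "route-QuantumAdvantage-AmplitudeProofs", crux]
def ApcCollapse : Prop :=
  ApcThesis → Literature.Computability.Cryptography.BQP ⊆ Literature.Computability.Complexity.Classes.P

/-- item stmt-QuantumAdvantage-2701 · support · rank 11 · open · by planner
sources: CookReckhow1979, FennerEtAl1999, arXiv:quant-ph/9812056, arXiv:0903.0675, FennerFortnowKurtz1994, AdlemanDeMarraisHuang1997
[support] Cook–Reckhow law for exact amplitudes (card c1): the zero-amplitude language AMP0 = {⟨C⟩ :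
C oracle-free Clifford+T on n wires, ⟨0^n|U_C|0^n⟩ = 0} has a polynomially bounded proof system iff
C=P ⊆ NP (C=P written inline as {L | ∃ g ∈ GapP, x ∈ L ↔ g x = 0}). Proof: tree theorem
hasPolyBoundedProofSystem_iff_mem_NP_holds reduces it to AMP0 ∈ NP ↔ C=P ⊆ NP, i.e. to
C=P-completeness of AMP0 under Karp reductions: (∈) ⟨0|C|0⟩ = 2^{-h/2}(a + bω + cω² + dω³) with
a,b,c,d ∈ GapP uniformly in C (path sums, tree CliffordTPathSums.pathAmp /
prodZeta_mulVec_basisState_apply) and 1,ω,ω²,ω³ ℚ-independent, so ⟨0|C|0⟩ = 0 ↔ a²+b²+c²+d² = 0, one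
GapP function (closure under +,×: FennerFortnowKurtz1994 §3); (hard) for g ∈ GapP a P-uniform
Clifford+T circuit C_x (Hadamard test around the reversible circuit of the P-relation, inputs
hard-wired by X = HSSH) has ⟨0|C_x|0⟩ = −g(x)/2^{p(|x|)} (FennerEtAl1999 Thm 'GapP→quantum',
arXiv:quant-ph/9812056 p.7; tree reversible-compilation stack RevTableau/ReversibleCliffordT), so {x
| g x = 0} ≤p AMP0; NP closed under ≤p (mem_NP_of_karpReducible). [CookReckhow1979 Prop 1.4;
FennerEtAl1999; AdlemanDeMarraisHuang1997; Tanaka arXiv:0903.0675 (NQP-comple -/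
@[route_item "route-QuantumAdvantage-AmplitudeProofs"]
def ApcCookReckhow : Prop :=
  Literature.Computability.MetaComplexity.HasPolyBoundedProofSystem {w : List Bool | ∃ (n : ℕ) (C : Literature.Computability.Cryptography.QCircuit Literature.Computability.Cryptography.cliffordT (n + 0)), C.IsOracleFree ∧ w = Literature.Computability.Cryptography.QCircuit.sigmaEncode ⟨n, 0, C⟩ ∧ C.runOn 0 (Literature.Computability.Cryptography.zeroState (n + 0)) (fun _ => false) = 0} ↔ ∀ L : Language Bool, (∃ g ∈ Literature.Computability.Complexity.GapP, ∀ x : List Bool, x ∈ L ↔ g x = 0) → L ∈ Literature.Computability.Complexity.Nondeterministic.NP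

/-- item stmt-QuantumAdvantage-2702 · support · rank 12 · open · by planner
sources: CookReckhow1979, arXiv:2004.06455, Capelli2019
[support] The CNF-diagram dictionary: UNSAT ≤p AMP0. For a CNF F on v variables build the
oracle-free Clifford+T circuit C_F on v + a + 1 wires: H on the v variable wires; reversibly compute
o := F(x) with Toffolis (7 T gates each) and uncompute the a ancillas; H on the variable wires
again; X = HSSH on o. Then ⟨0…0|U_{C_F}|0…0⟩ = #SAT(F)/2^v, so ⟨C_F⟩ ∈ AMP0 ↔ F unsatisfiable; the
map F ↦ sigmaEncode ⟨v+a+1, 0, C_F⟩ is FP (invalid CNF codes ↦ the empty 0-wire circuit, amplitude 1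
∉ AMP0). CONSEQUENCE used by the cruxes: for every proof system V for AMP0, (φ, π) ↦ V (f φ) π is a
Cook–Reckhow refutation system for CNFs, so amplitude proof systems sit in the classical hierarchy
and inherit its lower-bound problems; the ZH-calculus form of C_F is the standard #SAT tensor
network (arXiv:2004.06455 Thm 'zh-sat-rep', p.9: its variable-elimination rewrite is Davis–Putnam
resolution). [CookReckhow1979; arXiv:2004.06455; Valiant1979 (#SAT); tree UNSAT,
PolyTimeKarpReducible, encodingCNF] -/
@[route_item "route-QuantumAdvantage-AmplitudeProofs"]
def ApcUnsatReduces : Prop :=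
  Literature.Computability.Complexity.PolyTimeKarpReducible Literature.Computability.Complexity.UNSAT {w : List Bool | ∃ (n : ℕ) (C : Literature.Computability.Cryptography.QCircuit Literature.Computability.Cryptography.cliffordT (n + 0)), C.IsOracleFree ∧ w = Literature.Computability.Cryptography.QCircuit.sigmaEncode ⟨n, 0, C⟩ ∧ C.runOn 0 (Literature.Computability.Cryptography.zeroState (n + 0)) (fun _ => false) = 0}

/-- item stmt-QuantumAdvantage-2703 · support · rank 13 · open · by planner
sources: AaronsonGottesman2004, BravyiGosset2016, Gottesman1998
[support] Simulators are provers, upper-bound direction (the Cook–Reckhow reading of brute-force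
T-expansion / flat stabilizer sums): AMP0 has a proof system V whose true statements ⟨C⟩ have proofs
of length ≤ 2^{tCount C}·(|⟨C⟩|^c + c). Proof: take π = padding 1^{2^t·(|⟨C⟩|^c+c)}; V(⟨C⟩, π)
decodes C, expands its t T-gates as T = αI + βZ into ≤ 2·4^t ≤ 2|π|² Clifford amplitude terms in
ℤ[ω,1/2], computes each exactly in poly(n) time by Gottesman–Knill / Aaronson–Gottesman with phases
(AaronsonGottesman2004 §III–IV; BravyiGosset2016 §3), and accepts iff the sum is 0 — time polynomial
in |boolPair ⟨C⟩ π|, sound and complete by construction. Same mathematics as Dequantize's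
DeqLogTcountInPV2 (t = O(log n) ⇒ P), phrased as proof LENGTH so that ApcMagicRankExponential reads
'optimal up to the exponent for SD-type certificates'. [AaronsonGottesman2004; BravyiGosset2016;
Gottesman1998; tree QCircuit.tCount (TCount.lean)] -/
@[route_item "route-QuantumAdvantage-AmplitudeProofs"]
def ApcTcountProofs : Prop :=
  ∃ V : List Bool → List Bool → Bool, Literature.Computability.MetaComplexity.IsProofSystemFor V {w : List Bool | ∃ (n : ℕ) (C : Literature.Computability.Cryptography.QCircuit Literature.Computability.Cryptography.cliffordT (n + 0)), C.IsOracleFree ∧ w = Literature.Computability.Cryptography.QCircuit.sigmaEncode ⟨n, 0, C⟩ ∧ C.runOn 0 (Literature.Computability.Cryptography.zeroState (n + 0)) (fun _ => false) = 0} ∧ ∃ c : ℕ, ∀ (n : ℕ) (C : Literature.Computability.Cryptography.QCircuit Literature.Computability.Cryptography.cliffordT (n + 0)), C.IsOracleFree → C.runOn 0 (Literature.Computability.Cryptography.zeroState (n + 0)) (fun _ => false) = 0 → ∃ π : List Bool, π.length ≤ 2 ^ C.tCount * ((Literature.Computability.Cryptography.QCircuit.sigmaEncode ⟨n, 0, C⟩).length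 ^ c + c) ∧ V (Literature.Computability.Cryptography.QCircuit.sigmaEncode ⟨n, 0, C⟩) π = true

/-- item stmt-QuantumAdvantage-2704 · support · rank 14 · open · by planner
sources: BravyiGosset2016, PelegShpilkaVolk2022
[support] Glue from the magic family to the prefix-rank crux: if the exact stabilizer rank of
|T>^{⊗t} is superpolynomial (∀c ∃t, t^c + c < χ(tensorPow magicT t)) then ApcPrefixRankSuperpoly.
Proof: the family F with ancillas n := 0 and circ n := [H then T on each wire i < n] is oracle-free
and poly-time uniform; on input x = 0^t its state after 2t gates is ⊗_i T H|0⟩ = |T>^{⊗t} (as a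
vector on QReg (t+0), up to the tensorVec/Fin.append bookkeeping), so χ(F.stateAfter (replicate t
false) (2t)) = χ(tensorPow magicT t) and |x| = t. Makes ApcMagicRankExponential ⇒
ApcPrefixRankSuperpoly and links route Dequantize (DeqNegStabrankSuperpoly ⇒ hypothesis, since χ_δ ≤
χ: tree approxStabilizerRank_le_stabilizerRank). [BravyiGosset2016 eq.(2); tree StabilizerRank.lean] -/
@[route_item "route-QuantumAdvantage-AmplitudeProofs"]
def ApcOfMagicRank : Prop :=
  (∀ c : ℕ, ∃ t : ℕ, t ^ c + c < Literature.Computability.QuantumComplexity.stabilizerRank (Literature.Computability.QuantumComplexity.tensorPow Literature.Computability.QuantumComplexity.magicT t)) → ApcPrefixRankSuperpoly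

/-- item stmt-QuantumAdvantage-2705 · support · rank 15 · open · by planner
sources: MehrabanTahmasbi2024, arXiv:2305.10277, AaronsonGottesman2004, BravyiGosset2016, Adleman1978
[support] What the negation of ApcPrefixRankSuperpoly buys (SD-level dequantization, non-uniform):
if every uniform oracle-free Clifford+T family has polynomially bounded exact prefix stabilizer rank
on all inputs, then BQP ⊆ P/poly. Proof: for L ∈ BQP via F₀ build the uniform family G that prepares
N Bell pairs (H, CNOT) and runs F₀.circ N on the second halves plus ancillas; on input 0…0 its final
state is the Choi-type state Ψ_N = (I ⊗ U_N)(|Φ⁺>^{⊗N}|0^m>), of rank r ≤ poly(N) by hypothesis.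
Advice = a decomposition Ψ_N = Σ_{i<r} c_i φ_i with φ_i given by O(M²)-size Clifford words and c_i ∈
ℚ(ω) of poly bit-size (a ℂ-decomposition into r independent stabilizer states has its coordinates in
ℚ(ω) by Cramer, entries of all vectors lying in 2^{-k}ℤ[ω]). Then Pr[accept x] = 2^N Σ_{i,j}
conj(c_i) c_j ⟨φ_i|(|x><x| ⊗ Π_{out=1})|φ_j⟩, r² stabilizer inner products with single-qubit
projectors, each exact in poly time (AaronsonGottesman2004 §III; BravyiGosset2016 §3 phase-sensitive
overlaps); compare with 1/2 in ℚ(ω). Exact-rank / Choi-state analogue of MehrabanTahmasbi2024 Thm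
1.10 (arXiv:2305.10277 p.6) and of Dequantize's DeqStabrankPolyImpliesBQPSubsetPPoly; cross-route:
hypothesis ⇒ ¬C -/
@[route_item "route-QuantumAdvantage-AmplitudeProofs"]
def ApcPolyPrefixRankCollapse : Prop :=
  (∀ F : Literature.Computability.Cryptography.QCircuitFamily Literature.Computability.Cryptography.cliffordT, F.IsOracleFree → F.IsUniform → ∃ c : ℕ, ∀ (x : List Bool) (j : ℕ), Literature.Computability.QuantumComplexity.stabilizerRank (F.stateAfter x j) ≤ x.length ^ c + c) → Literature.Computability.Cryptography.BQP ⊆ Literature.Computability.Complexity.PPoly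

/-- item stmt-QuantumAdvantage-2706 · assembly · rank 1 · open · by planner
sources: CookReckhow1979, BernsteinVazirani1997
[assembly] ApcThesis → ¬QuantumAdvantage: from ApcCollapse (BQP ⊆ P) and the tree theorem
Literature.Computability.Complexity.P_subset_BPP_holds, BQP ⊆ BPP, contradicting ∃ L ∈ BQP, L ∉ BPP.
One line given ApcCollapse. -/
@[route_item "route-QuantumAdvantage-AmplitudeProofs"]
def Assembly : Prop :=
  ApcThesis → ¬ QuantumAdvantage

/-! D-0027 §2.1 — DECIDING THEOREM (planner-authored via `route open/edit --closes-file`; by planner-rbadge-QuantumAdvantage-AmplitudeProof-76c813ef-g2-0 2026-08-15T16:14:23Z):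
its hypotheses are this route's items and its conclusion the sub-problem Statement (glue_lint), and it elaborates with this file. -/

/-- D-0027 §2.1 deciding theorem of route AmplitudeProofs (refutation side: concludes `¬ QuantumAdvantage`).
The frame X_P (`ApcThesis`: a sound, polynomially bounded AND automatizable amplitude proof system on the
BQP promise — expected FALSE, it is the target the S-side length lower bounds shoot at) gives `BQP ⊆ P`
(`ApcCollapse`, Cook–Reckhow composition), hence `BQP ⊆ BPP` by the discharged tree fact
`Literature.Computability.Complexity.P_subset_BPP_holds` (Gill 1977, Prop. 5.1), which contradicts the
witness `∃ L ∈ BQP, L ∉ BPP` of `QuantumAdvantage`. -/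
@[closes "route-QuantumAdvantage-AmplitudeProofs"] theorem closes (h₀ : ApcThesis) (h₁ : ApcCollapse) : ¬ _root_.QuantumAdvantage :=
  fun ⟨_, hL, hnL⟩ => hnL (Literature.Computability.Complexity.P_subset_BPP_holds (h₁ h₀ hL))

end Summit.QuantumAdvantage.QuantumAdvantage.Theses.AmplitudeProofs
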